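import Literature.Geometry.Lorentzian.KerrConvergenceProofs
import Literature.Geometry.Lorentzian.ChartCalculus
import Mathlib.Analysis.SpecialFunctions.SmoothTransition

/-!
# Route EIHFluxBalance — `InertialRecession`: re-charting a lab chart (time reparametrisation)

Helper file for the crux `stmt-FinalStateConjecture-10166`
(`Summit.FinalStateConjecture.FinalStateConjecture.Theses.EIHFluxBalance.InertialRecession`).

The hypothesis of `InertialRecession` provides ONE lab chart `Φ : U → M` on an open set
`U ⊇ {x⁰ > τ₀, rᵢ > rinᵢ}`; its conclusion (`FinalStateDecomposition`) wants hole charts that are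
smooth on WHOLE boosted Kerr exteriors `{rᵢ > r₊}` — at all coordinate times, although only their
late parts matter. The standard remedy ("smoothness on the whole reference domain is a harmless
normalisation", module docstring of `Literature.Geometry.Lorentzian.KerrConvergence`) is a
smooth time reparametrisation `σ : ℝ → (τ₀, ∞)` with `σ = id` on `[τ₀ + 1, ∞)`: precomposing `Φ`
with `T(x) = x + (σ(x⁰) − x⁰) e₀` gives a chart defined wherever `T` lands in `U`, smooth, and
literally equal to `Φ` — with the same differential, hence the same pulled-back metric — at
every point with `x⁰ > τ₀ + 1`.

Contents (all `[folklore]` bookkeeping, no physics):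
* `exists_smooth_timeReparam`, `exists_timeReparamMap` — `σ` and `T`;
* `contMDiff_rechart` — `Ψ x = Φ ⟨T x, _⟩` is smooth on any open `Ω` with `T(Ω) ⊆ U`;
* `rechart_apply_of_le`, `mfderiv_rechart_apply`, `pullbackBilin_rechart` — on `{x⁰ > τ₀ + 1}`
  the re-charted map, its differential and its pulled-back metric are those of `Φ`;
* `isOpenEmbedding_restrict_rechart` — open-embedding property on late open subsets.
-/

noncomputable section

open scoped Manifold ContDiff Topology
open Filter Set TopologicalSpace Literature.Geometry.Lorentzian

namespace Summit.FinalStateConjecture.FinalStateConjecture.Theorems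

/-! ### A smooth time reparametrisation onto the late half-line -/

/-- A smooth map `σ : ℝ → ℝ` with values in `(τ₀, ∞)` which is the identity on `[τ₀ + 1, ∞)`:
`σ(t) = τ₀ + 1 + (t − τ₀ − 1)·θ(t − τ₀)` with Mathlib's `Real.smoothTransition` `θ`. [folklore] -/
theorem exists_smooth_timeReparam (τ₀ : ℝ) :
    ∃ σ : ℝ → ℝ, ContDiff ℝ ∞ σ ∧ (∀ t, τ₀ < σ t) ∧ ∀ t, τ₀ + 1 ≤ t → σ t = t := by
  refine ⟨fun t ↦ τ₀ + 1 + (t - τ₀ - 1) * Real.smoothTransition (t - τ₀), ?_, ?_, ?_⟩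
  · exact contDiff_const.add (((contDiff_id.sub contDiff_const).sub contDiff_const).mul
      (Real.smoothTransition.contDiff.comp (contDiff_id.sub contDiff_const)))
  · intro t
    have h0 := Real.smoothTransition.nonneg (t - τ₀)
    have h1 := Real.smoothTransition.le_one (t - τ₀)
    by_cases ht : τ₀ + 1 ≤ t
    · have h2 : 0 ≤ (t - τ₀ - 1) * Real.smoothTransition (t - τ₀) :=
        mul_nonneg (by linarith) h0
      show τ₀ < τ₀ + 1 + (t - τ₀ - 1) * Real.smoothTransition (t - τ₀)
      linarith
    · have ht2 : t < τ₀ + 1 := lt_of_not_ge ht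
      by_cases ht' : t ≤ τ₀
      · show τ₀ < τ₀ + 1 + (t - τ₀ - 1) * Real.smoothTransition (t - τ₀)
        rw [Real.smoothTransition.zero_of_nonpos (by linarith)]
        linarith
      · have ht3 : τ₀ < t := lt_of_not_ge ht'
        have h2 : (t - τ₀ - 1) * 1 ≤ (t - τ₀ - 1) * Real.smoothTransition (t - τ₀) :=
          mul_le_mul_of_nonpos_left h1 (by linarith)
        show τ₀ < τ₀ + 1 + (t - τ₀ - 1) * Real.smoothTransition (t - τ₀)
        linarith
  · intro t ht
    show τ₀ + 1 + (t - τ₀ - 1) * Real.smoothTransition (t - τ₀) = t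
    rw [Real.smoothTransition.one_of_one_le (by linarith)]
    ring

/-- **The time reparametrisation map** `T(x) = x + (σ(x⁰) − x⁰) e₀`: smooth, lands in the
half-space `{x⁰ > τ₀}`, preserves the spatial part, and is the identity on `{x⁰ ≥ τ₀ + 1}`.
[folklore] -/
theorem exists_timeReparamMap (τ₀ : ℝ) :
    ∃ T : E4 → E4, ContDiff ℝ ∞ T ∧ (∀ x, τ₀ < T x 0) ∧ (∀ x, E4.spatial (T x) = E4.spatial x) ∧
      ∀ x : E4, τ₀ + 1 ≤ x 0 → T x = x := by
  obtain ⟨σ, hσ, hσ₀, hσ₁⟩ := exists_smooth_timeReparam τ₀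
  have hp : ContDiff ℝ ∞ fun x : E4 ↦ x 0 := (EuclideanSpace.proj (0 : Fin 4) (𝕜 := ℝ)).contDiff
  refine ⟨fun x ↦ x + (σ (x 0) - x 0) • E4.basisVector 0, ?_, ?_, ?_, ?_⟩
  · exact contDiff_id.add (((hσ.comp hp).sub hp).smul contDiff_const)
  · intro x
    have h1 : (x + (σ (x 0) - x 0) • E4.basisVector 0) 0 = x 0 + (σ (x 0) - x 0) := by simp
    rw [h1]
    linarith [hσ₀ (x 0)]
  · intro x
    have h0 : E4.spatial (E4.basisVector 0) = 0 := by
      ext i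
      rw [E4.spatial_apply]
      simp
    show E4.spatial (x + (σ (x 0) - x 0) • E4.basisVector 0) = E4.spatial x
    rw [map_add, map_smul, h0, smul_zero, add_zero]
  · intro x hx
    show x + (σ (x 0) - x 0) • E4.basisVector 0 = x
    rw [hσ₁ _ hx, sub_self, zero_smul, add_zero]

/-! ### The re-charted map -/

section Rechart

variable {𝓢 : Spacetime 4} {U Ω : Opens E4} {Φ : U → 𝓢.carrier} {T : E4 → E4} {τ₀ : ℝ}
  (hT : ContDiff ℝ ∞ T) (hTid : ∀ x : E4, τ₀ + 1 ≤ x 0 → T x = x)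
  (hΩ : ∀ x ∈ Ω, T x ∈ U) {Ψ : Ω → 𝓢.carrier} (hΨ : ∀ x, Ψ x = Φ ⟨T x.1, hΩ x.1 x.2⟩)

include hΨ in
/-- The re-charted map `Ψ x = Φ(T x)` is smooth on `Ω` whenever `Φ` is smooth on `U ⊇ T(Ω)`
(composition with the smooth map `Ω → U` induced by `T`). [folklore] -/
theorem contMDiff_rechart (hT : ContDiff ℝ ∞ T) (hΦ : ContMDiff 𝓘(ℝ, E4) (𝓡 4) ∞ Φ) :
    ContMDiff 𝓘(ℝ, E4) (𝓡 4) ∞ Ψ := by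
  let G : Ω → U := fun x ↦ ⟨T x.1, hΩ x.1 x.2⟩
  have hval : ContMDiff 𝓘(ℝ, E4) 𝓘(ℝ, E4) ∞ (Subtype.val ∘ G) :=
    (contMDiff_iff_contDiff.mpr hT).comp contMDiff_subtype_val
  have hG : ContMDiff 𝓘(ℝ, E4) 𝓘(ℝ, E4) ∞ G := (ContMDiff.subtypeVal_comp_iff U G).1 hval
  have hΨ' : Ψ = Φ ∘ G := funext hΨ
  rw [hΨ']
  exact hΦ.comp hG

include hTid hΨ in
/-- On `{x⁰ ≥ τ₀ + 1}` the re-charted map IS `Φ`. [folklore] -/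
theorem rechart_apply_of_le (x : Ω) (hx : τ₀ + 1 ≤ x.1 0) (hxU : x.1 ∈ U) :
    Ψ x = Φ ⟨x.1, hxU⟩ := by
  rw [hΨ]
  congr 1
  exact Subtype.ext (hTid x.1 hx)

include hT hTid hΨ in
/-- On `{x⁰ > τ₀ + 1}` the differential of the re-charted map is that of `Φ` (chain rule; the
map `Ω → U` induced by `T` has identity differential there since `T = id` near the point).
[folklore] -/
theorem mfderiv_rechart_apply (hΦ : ContMDiff 𝓘(ℝ, E4) (𝓡 4) ∞ Φ) (x : Ω)
    (hx : τ₀ + 1 < x.1 0) (hxU : x.1 ∈ U) (v : E4) :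
    mfderiv 𝓘(ℝ, E4) (𝓡 4) Ψ x v = mfderiv 𝓘(ℝ, E4) (𝓡 4) Φ ⟨x.1, hxU⟩ v := by
  let G : Ω → U := fun x ↦ ⟨T x.1, hΩ x.1 x.2⟩
  have hval : ContMDiff 𝓘(ℝ, E4) 𝓘(ℝ, E4) ∞ (Subtype.val ∘ G) :=
    (contMDiff_iff_contDiff.mpr hT).comp contMDiff_subtype_val
  have hG : ContMDiff 𝓘(ℝ, E4) 𝓘(ℝ, E4) ∞ G := (ContMDiff.subtypeVal_comp_iff U G).1 hval
  have hΨ' : Ψ = Φ ∘ G := funext hΨ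
  have hGx : G x = ⟨x.1, hxU⟩ := Subtype.ext (hTid x.1 hx.le)
  -- the differential of `G` at `x` is the identity
  have h1 : MDifferentiableAt 𝓘(ℝ, E4) 𝓘(ℝ, E4) (Subtype.val : U → E4) (G x) :=
    (contMDiff_subtype_val (n := ∞)).mdifferentiableAt (by simp)
  have h2 : MDifferentiableAt 𝓘(ℝ, E4) 𝓘(ℝ, E4) G x := hG.mdifferentiableAt (by simp)
  have hc := mfderiv_comp x h1 h2
  have hfd : fderiv ℝ T x.1 = ContinuousLinearMap.id ℝ E4 := by
    have hev : T =ᶠ[𝓝 x.1] id := by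
      have hopen : IsOpen {y : E4 | τ₀ + 1 < y 0} :=
        isOpen_lt continuous_const (PiLp.continuous_apply 2 _ 0)
      filter_upwards [hopen.mem_nhds hx] with y hy
      exact hTid y (le_of_lt hy)
    rw [hev.fderiv_eq, fderiv_id]
  have hvalx : mfderiv 𝓘(ℝ, E4) 𝓘(ℝ, E4) (Subtype.val ∘ G) x = ContinuousLinearMap.id ℝ E4 := by
    rw [OpensChart.mfderiv_eq x (Subtype.val ∘ G) T (fun _ ↦ rfl)
      ((hT.differentiable (by simp)).differentiableAt), hfd]
  have hGv : mfderiv 𝓘(ℝ, E4) 𝓘(ℝ, E4) G x v = v := by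
    have e1 := OpensChart.mfderiv_subtypeVal_apply (G x) (mfderiv 𝓘(ℝ, E4) 𝓘(ℝ, E4) G x v)
    have e2 : mfderiv 𝓘(ℝ, E4) 𝓘(ℝ, E4) (Subtype.val ∘ G) x v = v := by
      rw [hvalx]; rfl
    rw [hc] at e2
    exact e1.symm.trans e2
  -- chain rule for `Φ ∘ G`
  have h3 : MDifferentiableAt 𝓘(ℝ, E4) (𝓡 4) Φ (G x) := hΦ.mdifferentiableAt (by simp)
  have hc2 := mfderiv_comp x h3 h2
  have k : mfderiv 𝓘(ℝ, E4) (𝓡 4) Ψ x = mfderiv 𝓘(ℝ, E4) (𝓡 4) (Φ ∘ G) x := by rw [hΨ']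
  refine (DFunLike.congr_fun k v).trans ((DFunLike.congr_fun hc2 v).trans ?_)
  refine (congrArg (fun u ↦ mfderiv 𝓘(ℝ, E4) (𝓡 4) Φ (G x) u) hGv).trans ?_
  exact congrArg (fun z : U ↦ (mfderiv 𝓘(ℝ, E4) (𝓡 4) Φ z v : EuclideanSpace ℝ (Fin 4))) hGx

include hT hTid hΨ in
/-- On `{x⁰ > τ₀ + 1}` the metric pulled back by the re-charted map is the metric pulled back by
`Φ` (same point, same differential). [folklore] -/
theorem pullbackBilin_rechart (hΦ : ContMDiff 𝓘(ℝ, E4) (𝓡 4) ∞ Φ) (x : Ω)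
    (hx : τ₀ + 1 < x.1 0) (hxU : x.1 ∈ U) :
    pullbackBilin (I := 𝓡 4) (I' := 𝓘(ℝ, E4)) Ψ 𝓢.metric.val x =
      pullbackBilin (I := 𝓡 4) (I' := 𝓘(ℝ, E4)) Φ 𝓢.metric.val ⟨x.1, hxU⟩ := by
  let G : Ω → U := fun x ↦ ⟨T x.1, hΩ x.1 x.2⟩
  have hval : ContMDiff 𝓘(ℝ, E4) 𝓘(ℝ, E4) ∞ (Subtype.val ∘ G) :=
    (contMDiff_iff_contDiff.mpr hT).comp contMDiff_subtype_val
  have hG : ContMDiff 𝓘(ℝ, E4) 𝓘(ℝ, E4) ∞ G := (ContMDiff.subtypeVal_comp_iff U G).1 hval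
  have hΨ' : Ψ = Φ ∘ G := funext hΨ
  have hGx : G x = ⟨x.1, hxU⟩ := Subtype.ext (hTid x.1 hx.le)
  have hΦd : MDifferentiable 𝓘(ℝ, E4) (𝓡 4) Φ := hΦ.mdifferentiable (by simp)
  have hGd : MDifferentiable 𝓘(ℝ, E4) 𝓘(ℝ, E4) G := hG.mdifferentiable (by simp)
  -- the differential of `G` at `x` is the identity
  have h1 : MDifferentiableAt 𝓘(ℝ, E4) 𝓘(ℝ, E4) (Subtype.val : U → E4) (G x) :=
    (contMDiff_subtype_val (n := ∞)).mdifferentiableAt (by simp)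
  have hc := mfderiv_comp x h1 (hGd x)
  have hfd : fderiv ℝ T x.1 = ContinuousLinearMap.id ℝ E4 := by
    have hev : T =ᶠ[𝓝 x.1] id := by
      have hopen : IsOpen {y : E4 | τ₀ + 1 < y 0} :=
        isOpen_lt continuous_const (PiLp.continuous_apply 2 _ 0)
      filter_upwards [hopen.mem_nhds hx] with y hy
      exact hTid y (le_of_lt hy)
    rw [hev.fderiv_eq, fderiv_id]
  have hvalx : mfderiv 𝓘(ℝ, E4) 𝓘(ℝ, E4) (Subtype.val ∘ G) x = ContinuousLinearMap.id ℝ E4 := by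
    rw [OpensChart.mfderiv_eq x (Subtype.val ∘ G) T (fun _ ↦ rfl)
      ((hT.differentiable (by simp)).differentiableAt), hfd]
  have hGv : ∀ v : E4, mfderiv 𝓘(ℝ, E4) 𝓘(ℝ, E4) G x v = v := by
    intro v
    have e1 := OpensChart.mfderiv_subtypeVal_apply (G x) (mfderiv 𝓘(ℝ, E4) 𝓘(ℝ, E4) G x v)
    have e2 : mfderiv 𝓘(ℝ, E4) 𝓘(ℝ, E4) (Subtype.val ∘ G) x v = v := by
      rw [hvalx]; rfl
    rw [hc] at e2
    exact e1.symm.trans e2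
  -- chain rule for pullbacks along `Φ ∘ G`
  have hcomp := congrFun (pullbackBilin_comp (I' := 𝓘(ℝ, E4)) (I := 𝓘(ℝ, E4)) (I'' := 𝓡 4)
    hΦd hGd 𝓢.metric.val) x
  have e1 : ∀ v w : E4,
      pullbackBilin (I := 𝓡 4) (I' := 𝓘(ℝ, E4)) (Φ ∘ G) 𝓢.metric.val x v w =
        pullbackBilin (I := 𝓡 4) (I' := 𝓘(ℝ, E4)) Φ 𝓢.metric.val (G x) v w :=
    fun v w ↦ (DFunLike.congr_fun (DFunLike.congr_fun hcomp v) w).trans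
      (congrArg₂ (fun u u' ↦ pullbackBilin (I := 𝓡 4) (I' := 𝓘(ℝ, E4)) Φ 𝓢.metric.val
        (G x) u u') (hGv v) (hGv w))
  have key : pullbackBilin (I := 𝓡 4) (I' := 𝓘(ℝ, E4)) Ψ 𝓢.metric.val x =
      pullbackBilin (I := 𝓡 4) (I' := 𝓘(ℝ, E4)) (Φ ∘ G) 𝓢.metric.val x := by
    rw [hΨ']
  refine ContinuousLinearMap.ext fun v ↦ ContinuousLinearMap.ext fun w ↦ ?_
  refine (DFunLike.congr_fun (DFunLike.congr_fun key v) w).trans ((e1 v w).trans ?_)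
  exact congrArg (fun z : U ↦ (pullbackBilin (I := 𝓡 4) (I' := 𝓘(ℝ, E4)) Φ 𝓢.metric.val z :
    E4 →L[ℝ] E4 →L[ℝ] ℝ) v w) hGx

include hTid hΨ in
/-- The re-charted map restricted to a late open set `W ⊆ {x⁰ ≥ τ₀ + 1} ∩ U` is an open
embedding as soon as `Φ` is one on the late region `{x⁰ > τ₀}` of `U` (there `Ψ = Φ ∘ j` with
`j : W → {x⁰ > τ₀}` the inclusion of an open subset). [folklore] -/
theorem isOpenEmbedding_restrict_rechart
    (hemb : Topology.IsOpenEmbedding (Set.restrict {y : U | τ₀ < y.1 0} Φ))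
    {W : Set Ω} (hW : IsOpen W) (hW1 : ∀ x ∈ W, τ₀ + 1 ≤ x.1 0) (hWU : ∀ x ∈ W, x.1 ∈ U) :
    Topology.IsOpenEmbedding (W.restrict Ψ) := by
  have hc0 : Continuous fun y : E4 ↦ y 0 := PiLp.continuous_apply 2 _ 0
  have hL0 : IsOpen {y : U | τ₀ < y.1 0} :=
    isOpen_lt continuous_const (hc0.comp continuous_subtype_val)
  let j : W → {y : U | τ₀ < y.1 0} := fun x ↦
    ⟨⟨x.1.1, hWU x.1 x.2⟩, show τ₀ < x.1.1 0 by have := hW1 x.1 x.2; linarith⟩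
  have hg0 : Topology.IsOpenEmbedding (fun y : {y : U | τ₀ < y.1 0} ↦ (y.1.1 : E4)) :=
    U.isOpen.isOpenEmbedding_subtypeVal.comp hL0.isOpenEmbedding_subtypeVal
  have hg1 : Topology.IsOpenEmbedding (fun x : W ↦ (x.1.1 : E4)) :=
    Ω.isOpen.isOpenEmbedding_subtypeVal.comp hW.isOpenEmbedding_subtypeVal
  have hj : Topology.IsOpenEmbedding j := Topology.IsOpenEmbedding.of_comp j hg0 hg1
  have heq : W.restrict Ψ = Set.restrict {y : U | τ₀ < y.1 0} Φ ∘ j := by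
    funext x
    exact rechart_apply_of_le hTid hΩ hΨ x.1 (hW1 x.1 x.2) (hWU x.1 x.2)
  rw [heq]
  exact hemb.comp hj

end Rechart

end Summit.FinalStateConjecture.FinalStateConjecture.Theorems

end
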